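import Literature.MathematicalPhysics.QuantumFieldTheory.Balaban1983to89.B7Ineq139PathMass
import Literature.MathematicalPhysics.QuantumFieldTheory.Balaban1983to89.B7Prop3GeneralLinearBound
import Literature.MathematicalPhysics.QuantumFieldTheory.Balaban1983to89.B7Eq123General

/-!
# `Balaban1983to89.B7Ineq139General` — T. Bałaban, *Averaging operations for lattice gauge theories*, Commun. Math. Phys.
**98** (1985) 17–51 [Balaban1985Averaging]: **(139) AT A GENERAL REGULAR BACKGROUND** — «|Q_{V₀}A| ≦ Q|A|, |Q″(V₀)A| ≦
C′₁L²α₀Q″|A|» for B7's concrete linear part `L(Q(V₀)A)_c = B7Prop3GeneralLinear.linQcov`, with `C′₁ = C′₁(d, L)` explicit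
— file 2/2 of row B7.Eq139 @gen (file 1 = `B7Ineq139PathMass`)

statement-level skeleton of published theorems with citation tags; proofs where landed; nothing here is a claim about the Yang–Mills mass gap

PDF held: `paper:balaban1985-cmp98-averaging` (journal page = PDF page + 16); p. 39 [PDF 23] ((139)–(140)), p. 36 [PDF 20]
((124)–(126)), p. 34 [PDF 18] ((109), (115)) read from the materialised text layer and the renders
`b2b-balaban-ref1/pages/1985-cmp98-averaging/…-p023-x2.png`, `…-p020-x2.png`.

CITATION HEADER / WHAT IS REPRODUCED.  SKELETON row **B7.Eq139** (cell `lit-balaban`, seat p06 gen 3 = unit `lit-balaban-p06`;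
owner r04, referee ref-4).  Row status before this file (ROWS-B7 v3.3): «the one-step majorant (139) with C′₁ is proved @flat
only [`B7Prop5Flat`] and is the HYPOTHESIS `h139` of the @gen files [`B7Prop5GeneralLinear`, `B7Prop5GeneralInduction`]».
p. 39, verbatim: *"From (124) it is clear that we have the inequalities |Q_{V₀}A| ≦ Q|A|, |Q″(V₀)A| ≦ C′₁L²α₀Q″|A|, (139)
where the operator Q is defined as in [2], and Q″ is defined as (Q″A)_c = Σ_{b⊂B(c₋)∪B(c₊)} L^{−d}A_b. (140) The constant
C′₁ depends on d and L."*  p. 36: *"The remaining terms are small because the functions g(−z), g⁻¹(z), e^{iz} are equal to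
1 for z = 0, so the operators occurring in these terms can be estimated by O(L²α₀) … (Q₀A)_c = (Q_{V₀}A)_c = Σ_{x∈B(c₋)}
L^{−(d+1)}(R_{0,c₋}A)([x, x′]), (125) and it has an estimate |(Q₀A)_c| ≤ |A|"*.

THE PRINTED ROUTE, FOLLOWED.  (124) = `B7Prop3GeneralLinearSplit.linQcov_split`: `L(Q(V₀)A)_c = L·(Q₀A)_c + [three
brackets]`, each bracket a difference `[operator − 1](rotated contour sum)` with the operators `Φ = g(−i ad_Y)`, `Ψ_x =
g⁻¹(−i ad_{Y_x})`, `e^{i ad}`, «equal to 1 for z = 0» and of defect `O(ε)` for block loops `‖W_x(V₀) − 1‖ ≤ ε`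
(`B7Prop3GeneralLinearBound`, BY NAME); the contour sums are bounded by their `ℓ¹` masses (file 1), all contours living in
`B(c₋) ∪ B(c₊)`.  Hence «|Q″(V₀)A| ≦ C′₁L²α₀Q″|A|» with `C′₁L²α₀ ↦ 100·ε·Lᵈ` (`ε = 16(d+1)(d+4)L²α₀` under (109) by Prop. 1,
`B7Prop2Explicit.norm_Wcx_sub_one_le`), i.e. `C′₁ = 1600(d+1)(d+4)L^{d−1}·L` in «L(Q(V₀)A)_c» units — «depends on d and
L»; and «|Q_{V₀}A| ≦ Q|A|» EXACTLY (the segment masses of (125) sum to `L·(Q|A|)_c`).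

DICTIONARY: as in file 1 (`c = ⟨q, q + Le_κ⟩`, «b ⊂ B(c₋)∪B(c₊)» ↦ `S1 L q κ`, `L·Q ↦ avQ L`, `Q″ ↦ ddQ L`, `|A| ↦ fun x κ ↦
‖A x κ‖`); `L(Q(V₀)A)_c ↦ linQcov L V₀ A q κ`, `L·(Q₀A)_c ↦ (L : ℝ) • Q0cov L V₀ A q κ`; the regime: `V₀` unit-bounded
(`U1`, e.g. unitary) with block loops `‖W_x(V₀) − 1‖ ≤ ε ≤ 1/8` at `c` (§1–§3), or the plaquette regularity (109)/(52)
(`…_of_plaquettes`, `…_of_pdev`).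

WHAT THIS FILE PROVES (kernel, 0 sorry, standard axioms; theorems only): §1 `norm_Aloop_le_mass` (`‖A_x^{(1)}‖ ≤
4·Σ_{b⊂B(c₋)∪B(c₊)}|A_b|` by (115)), **`norm_Q0cov_le_avQ`** = (139) FIRST HALF «|Q_{V₀}A| ≦ Q|A|» (`‖L·(Q₀A)_c‖ ≤ avQ L |A|
(c)`); §2 the three brackets of (124) with masses (`80ε`, `10ε`, `10ε` × the two-block mass) and
**`norm_linQcov_sub_main_le_ddQ`** = (139) SECOND HALF «|Q″(V₀)A| ≦ C′₁L²α₀Q″|A|» (`‖L(Q(V₀)A)_c − L·(Q₀A)_c‖ ≤ 100·ε·Lᵈ·ddQ L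
|A| (c)`); §3 **`ineq139_general`** (`‖L(Q(V₀)A)_c‖ ≤ avQ L |A| (c) + 100εLᵈ·ddQ L |A| (c)`), **`ineq139_general_of_plaquettes`**
(under (109): coefficient `1600(d+1)(d+4)L^{d+2}α₀`), **`ineq139_general_of_pdev`** (under `pdev V₀ < β ≤ 1/(1024(d+1)(d+4)L²)`:
coefficient `1600(d+1)(d+4)L^{d+2}β`) — the last is LITERALLY the binder `h139` of `B7Prop5GeneralLinear.ineq143` /
`B7Prop5GeneralInduction.ineq149` at one background (the level instantiation is `B7Prop5General`).
DIVERGENCES from print: `C′₁`'s value is an admissible witness for the unprinted constant, not optimal (loop multiplicities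
bounded by `4`); the loop regime `ε ≤ 1/8` is the lineage's; everything in «L(Q(V₀)A)_c» units (one factor `L`, (122));
`ℤᵈ`, corner blocks, `U1` background as in `B7Prop3GeneralLinear*`.
RELATION TO THE SUBSTRATE: `Summits/…/Support/ShellMeasureAverageMajorant(Pdev)` proves (139) Summits-side over
`B7BlockGeometry.Qav/Qdd`; this is the Literature reproduction in the consumers' currency; no substrate declaration is
re-declared or moved (INTERFACES IF2-27: R5 pairing; precedents p246433 (123), p247534 (148)).
-/

noncomputable section

open scoped BigOperators
open NormedSpace Finset

namespace Literature.MathematicalPhysics.QuantumFieldTheory.Balaban1983to89.B7Ineq139General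

open B7Prop1Explicit B7Prop2Explicit B7Prop3Flat B7Eq92Concrete MatrixLog B7Prop3GeneralRotated B7Prop3GeneralLinear
  B7Prop3GeneralTild B7Prop3GeneralLinearSplit B7Prop3GeneralLinearBound B7Prop5GeneralOperators B7Ineq139PathMass
open B7Eq123General (blockLoops_of_pdev)
open B7Eq78Linearization (conjR conjR_apply conjR_sub conjR_one)
open B12AverageCorridor267 (Dmlog PhiY PhiY_apply expU)
open B7Prop5Flat (S1)

-- `Site` alone would resolve to the torus sites of `Setup.lean`; re-export the `ℤ^d` sites of `B7Prop1Explicit`.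
export B7Prop1Explicit (Site)

variable {d : ℕ}

variable {𝔸 : Type*} [NormedRing 𝔸] [NormedAlgebra ℂ 𝔸] [NormOneClass 𝔸] [CompleteSpace 𝔸]
variable (L : ℕ)

/-! ## §1 The loop functional `A_x^{(1)}` and the pieces of (124)/(125) are majorised by the two-block mass -/

section Pieces

variable {V₀ : Site d → Fin d → 𝔸ˣ} (hV₀ : ∀ x κ, V₀ x κ ∈ U1 𝔸) (A : Site d → Fin d → 𝔸) (hL : 1 ≤ L) (q : Site d)
  (κ : Fin d)

omit [NormedAlgebra ℂ 𝔸] [CompleteSpace 𝔸] in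
include hV₀ hL in
/-- **`‖A_x^{(1)}‖ ≤ 4·Σ_{b⊂B(c₋)∪B(c₊)}|A_b|`**: by (115) (`Aloop_eq`) the loop functional is the sum of four rotated contour
sums — along the tree contours `Γ_{c₋,x}`, `Γ_{c₊,x′}`, the segment `[x, x′]` and the bond `c` — each majorised by its mass
(`norm_tsum_le_pathMass`) and each living in the two blocks. [cite: Balaban1985Averaging, (115) p.34, (139)–(140) p.39] -/
theorem norm_Aloop_le_mass (r : Fin d → Fin L) :
    ‖Aloop L V₀ A q κ (boxVec L r)‖ ≤ 4 * ∑ b ∈ S1 L q κ, ‖A b.1 b.2‖ := by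
  have hL' : 0 < L := hL
  set S := ∑ b ∈ S1 L q κ, ‖A b.1 b.2‖
  have h1 : ‖tsum V₀ A q (treeWord (boxVec L r))‖ ≤ S :=
    (norm_tsum_le_pathMass hV₀ A _ _).trans (pathMass_treeWord_le L A q κ r)
  have h2 : ‖conjR (hol V₀ q (treeWord (boxVec L r))) (tsum V₀ A (q + boxVec L r) (seg κ L))‖ ≤ S :=
    (norm_conjR_le (hol_mem hV₀ _ _) _).trans ((norm_tsum_le_pathMass hV₀ A _ _).trans
      (pathMass_seg_le L A q κ r))
  have h3 : ‖conjR (hol V₀ q (gammaWord L κ (boxVec L r))) (tsum V₀ A (q + (L : ℤ) • e κ) (treeWord (boxVec L r)))‖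
      ≤ S :=
    (norm_conjR_le (hol_mem hV₀ _ _) _).trans ((norm_tsum_le_pathMass hV₀ A _ _).trans
      (pathMass_treeWord_le' L A q κ r))
  have h4 : ‖conjR (Wcx L V₀ q κ (boxVec L r)) (tsum V₀ A q (seg κ L))‖ ≤ S :=
    (norm_conjR_le (Wcx_mem L hV₀ _ κ _) _).trans ((norm_tsum_le_pathMass hV₀ A _ _).trans
      (pathMass_seg_corner_le L hL' A q κ))
  rw [Aloop_eq]
  have e1 := norm_sub_le (tsum V₀ A q (treeWord (boxVec L r))
    + conjR (hol V₀ q (treeWord (boxVec L r))) (tsum V₀ A (q + boxVec L r) (seg κ L))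
    - conjR (hol V₀ q (gammaWord L κ (boxVec L r))) (tsum V₀ A (q + (L : ℤ) • e κ) (treeWord (boxVec L r))))
    (conjR (Wcx L V₀ q κ (boxVec L r)) (tsum V₀ A q (seg κ L)))
  have e2 := norm_sub_le (tsum V₀ A q (treeWord (boxVec L r))
    + conjR (hol V₀ q (treeWord (boxVec L r))) (tsum V₀ A (q + boxVec L r) (seg κ L)))
    (conjR (hol V₀ q (gammaWord L κ (boxVec L r))) (tsum V₀ A (q + (L : ℤ) • e κ) (treeWord (boxVec L r))))
  have e3 := norm_add_le (tsum V₀ A q (treeWord (boxVec L r)))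
    (conjR (hol V₀ q (treeWord (boxVec L r))) (tsum V₀ A (q + boxVec L r) (seg κ L)))
  linarith

omit [NormedAlgebra ℂ 𝔸] [CompleteSpace 𝔸] in
include hV₀ hL in
/-- `‖(R_{0,c₋}A)(c)‖ ≤ Σ_{b⊂B(c₋)∪B(c₊)}|A_b|` (the bond `c` is the segment from the corner `c₋`). [cite: Balaban1985Averaging, (139)–(140) p.39] -/
theorem norm_tsum_bond_le_mass : ‖tsum V₀ A q (seg κ L)‖ ≤ ∑ b ∈ S1 L q κ, ‖A b.1 b.2‖ :=
  (norm_tsum_le_pathMass hV₀ A _ _).trans (pathMass_seg_corner_le L hL A q κ)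

omit [NormedAlgebra ℂ 𝔸] [CompleteSpace 𝔸] in
include hV₀ in
/-- `‖R(V₀(c))(R_{0,c₊}A)(Γ_{c₊,x′})‖ ≤ Σ_{b⊂B(c₋)∪B(c₊)}|A_b|`. [cite: Balaban1985Averaging, (139)–(140) p.39] -/
theorem norm_tsum_tree'_le_mass (r : Fin d → Fin L) :
    ‖conjR (hol V₀ q (seg κ L)) (tsum V₀ A (q + (L : ℤ) • e κ) (treeWord (boxVec L r)))‖
      ≤ ∑ b ∈ S1 L q κ, ‖A b.1 b.2‖ :=
  (norm_conjR_le (hol_mem hV₀ _ _) _).trans ((norm_tsum_le_pathMass hV₀ A _ _).trans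
    (pathMass_treeWord_le' L A q κ r))

omit [CompleteSpace 𝔸] in
include hV₀ hL in
/-- **(139), FIRST HALF: «|Q_{V₀}A| ≦ Q|A|»** for the main term (125), in «L(Q(V₀)A)_c» units: `‖L·(Q₀A)_c‖ ≤ avQ L |A| (c)`
(`avQ = L·Q`, `Q` of [2] (1.11) acting on `b ↦ |A_b|`) — each rotated segment sum `≤` the segment's mass, summed with the
weights `L^{−(d+1)}`, and the segment masses sum to `Q|A|` exactly. [cite: Balaban1985Averaging, (139) p.39, (125) p.36] -/
theorem norm_Q0cov_le_avQ : ‖(L : ℝ) • Q0cov L V₀ A q κ‖ ≤ avQ L (fun x μ => ‖A x μ‖) q κ := by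
  have hL' : 0 < L := hL
  rw [← sum_pathMass_seg_eq_avQ L hL' A q κ, norm_smul, Real.norm_of_nonneg (Nat.cast_nonneg L), Q0cov]
  refine mul_le_mul_of_nonneg_left (norm_sum_le_of_le _ fun r _ => ?_) (Nat.cast_nonneg L)
  rw [norm_smul, Real.norm_of_nonneg (by positivity)]
  exact mul_le_mul_of_nonneg_left ((norm_conjR_le (hol_mem hV₀ _ _) _).trans (norm_tsum_le_pathMass hV₀ A _ _))
    (by positivity)

end Pieces

/-! ## §2 The three defect brackets of (124) with masses: `O(ε)·Σ_{b⊂B(c₋)∪B(c₊)}|A_b|` -/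

section Brackets

variable {V₀ : Site d → Fin d → 𝔸ˣ} (hV₀ : ∀ x κ, V₀ x κ ∈ U1 𝔸) (A : Site d → Fin d → 𝔸) (hL : 1 ≤ L) (q : Site d)
  (κ : Fin d) {ε : ℝ} (hε0 : 0 ≤ ε) (hε : ε ≤ 1 / 8)
  (hW : ∀ r : Fin d → Fin L, ‖((Wcx L V₀ q κ (boxVec L r) : 𝔸ˣ) : 𝔸) - 1‖ ≤ ε)

include hV₀ hL hε0 hε hW in
/-- FIRST BRACKET of (124) with masses: `‖Φ(Σ_x L^{−d}Ψ_x(A_x^{(1)})) − Σ_x L^{−d}A_x^{(1)}‖ ≤ 80·ε·Σ_{b⊂B(c₋)∪B(c₊)}|A_b|`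
(`20ε` times the uniform loop bound `4·Σ|A_b|`; `Φ − 1`, `Ψ_x − 1` «estimated by O(L²α₀)»). [cite: Balaban1985Averaging, (124)–(126) p.36, (139) p.39] -/
theorem norm_bracket1_le_mass :
    ‖PhiY (Xavg L V₀ q κ) (DXavg L V₀ A q κ)
        - ∑ r : Fin d → Fin L, (((L : ℝ) ^ d)⁻¹) • Aloop L V₀ A q κ (boxVec L r)‖
      ≤ 80 * ε * ∑ b ∈ S1 L q κ, ‖A b.1 b.2‖ := by
  set ℓ : ℝ := 4 * ∑ b ∈ S1 L q κ, ‖A b.1 b.2‖ with hℓ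
  have hℓ0 : 0 ≤ ℓ := by positivity
  have hX := norm_Xavg_le L hL V₀ q κ hε hW
  have hAl : ∀ r, ‖Aloop L V₀ A q κ (boxVec L r)‖ ≤ ℓ := fun r => norm_Aloop_le_mass L hV₀ A hL q κ r
  set S := ∑ r : Fin d → Fin L, (((L : ℝ) ^ d)⁻¹) • Aloop L V₀ A q κ (boxVec L r) with hS
  have hin : ‖DXavg L V₀ A q κ - S‖ ≤ 6 * ε * ℓ := by
    rw [hS, DXavg, ← Finset.sum_sub_distrib]
    simp_rw [← smul_sub]
    refine norm_wsum_le L hL fun r => ?_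
    refine (norm_Dmlog_mul_right_sub_self_le (Wcx_mem L hV₀ q κ _) hε0 hε (hW r) _).trans ?_
    exact mul_le_mul_of_nonneg_left (hAl r) (by positivity)
  have hSn : ‖S‖ ≤ ℓ := norm_wsum_le L hL hAl
  have hDX : ‖DXavg L V₀ A q κ‖ ≤ 6 * ε * ℓ + ℓ := by
    have h := norm_add_le (DXavg L V₀ A q κ - S) S
    rw [sub_add_cancel] at h
    linarith
  have hΦ := norm_PhiY_sub_self_le hX hε (DXavg L V₀ A q κ)
  have key : ‖PhiY (Xavg L V₀ q κ) (DXavg L V₀ A q κ) - S‖ ≤ 8 * ε * (6 * ε * ℓ + ℓ) + 6 * ε * ℓ := by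
    have h := norm_add_le (PhiY (Xavg L V₀ q κ) (DXavg L V₀ A q κ) - DXavg L V₀ A q κ) (DXavg L V₀ A q κ - S)
    rw [sub_add_sub_cancel] at h
    have h8 : 8 * ε * ‖DXavg L V₀ A q κ‖ ≤ 8 * ε * (6 * ε * ℓ + ℓ) := mul_le_mul_of_nonneg_left hDX (by positivity)
    linarith
  have h8 : 8 * ε ≤ 1 := by linarith
  have h6 : 0 ≤ 6 * ε * ℓ := by positivity
  have hε2 : 8 * ε * (6 * ε * ℓ) ≤ 6 * ε * ℓ := by
    calc 8 * ε * (6 * ε * ℓ) ≤ 1 * (6 * ε * ℓ) := mul_le_mul_of_nonneg_right h8 h6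
      _ = 6 * ε * ℓ := one_mul _
  have e : 8 * ε * (6 * ε * ℓ + ℓ) = 8 * ε * (6 * ε * ℓ) + 8 * ε * ℓ := by ring
  calc ‖PhiY (Xavg L V₀ q κ) (DXavg L V₀ A q κ) - S‖ ≤ 8 * ε * (6 * ε * ℓ + ℓ) + 6 * ε * ℓ := key
    _ ≤ 20 * ε * ℓ := by rw [e]; linarith
    _ = 80 * ε * ∑ b ∈ S1 L q κ, ‖A b.1 b.2‖ := by rw [hℓ]; ring

include hV₀ hL hε0 hε hW in
/-- SECOND BRACKET of (124) with masses: `‖[e^{i ad_Y} − Σ_x L^{−d}R(W_x)]((R_{0,c₋}A)(c))‖ ≤ 10·ε·Σ_{b⊂B(c₋)∪B(c₊)}|A_b|`.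
[cite: Balaban1985Averaging, (124)–(126) p.36, (139) p.39] -/
theorem norm_bracket2_le_mass :
    ‖conjR (expUnit (Xavg L V₀ q κ)) (tsum V₀ A q (seg κ L))
        - ∑ r : Fin d → Fin L, (((L : ℝ) ^ d)⁻¹) • conjR (Wcx L V₀ q κ (boxVec L r)) (tsum V₀ A q (seg κ L))‖
      ≤ 10 * ε * ∑ b ∈ S1 L q κ, ‖A b.1 b.2‖ := by
  set Rc := tsum V₀ A q (seg κ L) with hRc
  have hR : ‖Rc‖ ≤ ∑ b ∈ S1 L q κ, ‖A b.1 b.2‖ := norm_tsum_bond_le_mass L hV₀ A hL q κ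
  have hX := norm_Xavg_le L hL V₀ q κ hε hW
  have h1 : ‖conjR (expUnit (Xavg L V₀ q κ)) Rc - Rc‖ ≤ 8 * ε * ‖Rc‖ := norm_conjR_expUnit_sub_self_le hX hε Rc
  have h2 : ‖∑ r : Fin d → Fin L, (((L : ℝ) ^ d)⁻¹) • conjR (Wcx L V₀ q κ (boxVec L r)) Rc - Rc‖ ≤ 2 * ε * ‖Rc‖ := by
    have e : ∑ r : Fin d → Fin L, (((L : ℝ) ^ d)⁻¹) • conjR (Wcx L V₀ q κ (boxVec L r)) Rc - Rc
        = ∑ r : Fin d → Fin L, (((L : ℝ) ^ d)⁻¹) • (conjR (Wcx L V₀ q κ (boxVec L r)) Rc - Rc) := by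
      simp_rw [smul_sub]
      rw [Finset.sum_sub_distrib, sum_blockWeight (d := d) L hL Rc]
    rw [e]
    exact norm_wsum_le L hL fun r => norm_conjR_sub_self_le (Wcx_mem L hV₀ q κ _) (hW r) Rc
  have h := norm_sub_le (conjR (expUnit (Xavg L V₀ q κ)) Rc - Rc)
    (∑ r : Fin d → Fin L, (((L : ℝ) ^ d)⁻¹) • conjR (Wcx L V₀ q κ (boxVec L r)) Rc - Rc)
  rw [sub_sub_sub_cancel_right] at h
  have hS0 : 0 ≤ ∑ b ∈ S1 L q κ, ‖A b.1 b.2‖ := by positivity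
  have h82 : 8 * ε * ‖Rc‖ + 2 * ε * ‖Rc‖ ≤ 10 * ε * ∑ b ∈ S1 L q κ, ‖A b.1 b.2‖ := by nlinarith
  linarith

include hV₀ hL hε0 hε hW in
/-- THIRD BRACKET of (124) with masses: `‖Σ_{x′} L^{−d}[e^{i ad_Y} − R(W_x)]R(V₀(c))(R_{0,c₊}A)(Γ_{c₊,x′})‖ ≤ 10·ε·Σ_{b⊂B(c₋)∪B(c₊)}|A_b|`.
[cite: Balaban1985Averaging, (124)–(126) p.36, (139) p.39] -/
theorem norm_bracket3_le_mass :
    ‖∑ r : Fin d → Fin L, (((L : ℝ) ^ d)⁻¹) •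
        (conjR (expUnit (Xavg L V₀ q κ))
            (conjR (hol V₀ q (seg κ L)) (tsum V₀ A (q + (L : ℤ) • e κ) (treeWord (boxVec L r))))
          - conjR (Wcx L V₀ q κ (boxVec L r))
            (conjR (hol V₀ q (seg κ L)) (tsum V₀ A (q + (L : ℤ) • e κ) (treeWord (boxVec L r)))))‖
      ≤ 10 * ε * ∑ b ∈ S1 L q κ, ‖A b.1 b.2‖ := by
  have hX := norm_Xavg_le L hL V₀ q κ hε hW
  have hS0 : 0 ≤ ∑ b ∈ S1 L q κ, ‖A b.1 b.2‖ := by positivity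
  refine norm_wsum_le L hL fun r => ?_
  set Y := conjR (hol V₀ q (seg κ L)) (tsum V₀ A (q + (L : ℤ) • e κ) (treeWord (boxVec L r))) with hY
  have hYn : ‖Y‖ ≤ ∑ b ∈ S1 L q κ, ‖A b.1 b.2‖ := norm_tsum_tree'_le_mass L hV₀ A q κ r
  have h1 := norm_conjR_expUnit_sub_self_le hX hε Y
  have h2 := norm_conjR_sub_self_le (Wcx_mem L hV₀ q κ (boxVec L r)) (hW r) Y
  have h := norm_sub_le (conjR (expUnit (Xavg L V₀ q κ)) Y - Y) (conjR (Wcx L V₀ q κ (boxVec L r)) Y - Y)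
  rw [sub_sub_sub_cancel_right] at h
  have h82 : 8 * ε * ‖Y‖ + 2 * ε * ‖Y‖ ≤ 10 * ε * ∑ b ∈ S1 L q κ, ‖A b.1 b.2‖ := by nlinarith
  linarith

include hV₀ hL hε0 hε hW in
/-- **THE REMAINDER `Q″(V₀)A` OF (124) IS MAJORISED BY THE TWO-BLOCK MASS**: `‖L(Q(V₀)A)_c − L·(Q₀A)_c‖ ≤
100·ε·Σ_{b⊂B(c₋)∪B(c₊)}|A_b|` for block loops `‖W_x − 1‖ ≤ ε ≤ 1∕8`. [cite: Balaban1985Averaging, (139)–(140) p.39, (124) p.36] -/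
theorem norm_linQcov_sub_main_le_mass :
    ‖linQcov L V₀ A q κ - (L : ℝ) • Q0cov L V₀ A q κ‖ ≤ 100 * ε * ∑ b ∈ S1 L q κ, ‖A b.1 b.2‖ := by
  have hW1 : ∀ r : Fin d → Fin L, ‖((Wcx L V₀ q κ (boxVec L r) : 𝔸ˣ) : 𝔸) - 1‖ < 1 :=
    fun r => (hW r).trans_lt (by linarith)
  have h1 := norm_bracket1_le_mass L hV₀ A hL q κ hε0 hε hW
  have h2 := norm_bracket2_le_mass L hV₀ A hL q κ hε0 hε hW
  have h3 := norm_bracket3_le_mass L hV₀ A hL q κ hε0 hε hW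
  rw [linQcov_split L hL V₀ A q κ hW1, add_assoc, add_assoc, add_sub_cancel_left]
  refine (norm_add_le _ _).trans ?_
  refine (add_le_add h1 ((norm_add_le _ _).trans (add_le_add h2 h3))).trans ?_
  linarith

include hV₀ hL hε0 hε hW in
/-- **(139), SECOND HALF: «|Q″(V₀)A| ≦ C′₁L²α₀Q″|A|»** in «L(Q(V₀)A)_c» units, loop regime: `‖L(Q(V₀)A)_c − L·(Q₀A)_c‖ ≤
100·ε·Lᵈ·ddQ L |A| (c)` (`ddQ = Q″` of (140); `C′₁L²α₀·L ↦ 100εLᵈ`, `ε` the block-loop regularity — «the constant C′₁ depends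
on d and L»). [cite: Balaban1985Averaging, (139)–(140) p.39] -/
theorem norm_linQcov_sub_main_le_ddQ :
    ‖linQcov L V₀ A q κ - (L : ℝ) • Q0cov L V₀ A q κ‖ ≤ 100 * ε * (L : ℝ) ^ d * ddQ L (fun x μ => ‖A x μ‖) q κ := by
  have h := norm_linQcov_sub_main_le_mass L hV₀ A hL q κ hε0 hε hW
  rwa [sum_S1_eq_ddQ L hL A q κ, ← mul_assoc] at h

end Brackets

/-! ## §3 (139) assembled: `|(Q(V₀)A)_c| ≤ (Q|A|)_c + C′₁L²α₀(Q″|A|)_c` -/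

section Majorant

variable {V₀ : Site d → Fin d → 𝔸ˣ} (hV₀ : ∀ x κ, V₀ x κ ∈ U1 𝔸) (A : Site d → Fin d → 𝔸) (hL : 1 ≤ L) (q : Site d)
  (κ : Fin d)

include hV₀ hL in
/-- **(139) AT A GENERAL BACKGROUND, LOOP REGIME**: `‖L(Q(V₀)A)_c‖ ≤ avQ L |A| (c) + 100·ε·Lᵈ·ddQ L |A| (c)` — i.e.
`|(Q(V₀)A)_c| ≤ (Q|A|)_c + C′₁L²α₀(Q″|A|)_c` — for a `U1` background whose block loops at `c` satisfy `‖W_x − 1‖ ≤ ε ≤ 1∕8`.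
[cite: Balaban1985Averaging, (139)–(140) p.39] -/
theorem ineq139_general {ε : ℝ} (hε0 : 0 ≤ ε) (hε : ε ≤ 1 / 8)
    (hW : ∀ r : Fin d → Fin L, ‖((Wcx L V₀ q κ (boxVec L r) : 𝔸ˣ) : 𝔸) - 1‖ ≤ ε) :
    ‖linQcov L V₀ A q κ‖ ≤
      avQ L (fun x μ => ‖A x μ‖) q κ + 100 * ε * (L : ℝ) ^ d * ddQ L (fun x μ => ‖A x μ‖) q κ := by
  have hmain := norm_Q0cov_le_avQ L hV₀ A hL q κ
  have h := norm_linQcov_sub_main_le_ddQ L hV₀ A hL q κ hε0 hε hW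
  have h' := norm_add_le (linQcov L V₀ A q κ - (L : ℝ) • Q0cov L V₀ A q κ) ((L : ℝ) • Q0cov L V₀ A q κ)
  rw [sub_add_cancel] at h'
  linarith

include hV₀ hL in
/-- **(139) FROM THE PLAQUETTE REGULARITY (109)**: if `|V₀(∂p) − 1| ≤ α₀` for all plaquettes with `512(d+1)(d+4)L²α₀ ≤ 1`,
`16(d+1)(d+4)L²α₀ ≤ 1∕8`, then `‖L(Q(V₀)A)_c‖ ≤ avQ L |A| (c) + 1600(d+1)(d+4)·L^{d+2}·α₀·ddQ L |A| (c)` — (139) with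
`C′₁L²α₀·L`, `C′₁ = 1600(d+1)(d+4)L^{d−1}` («C′₁ depends on d and L»; Prop. 1's mechanism `B7Prop2Explicit.norm_Wcx_sub_one_le`
BY NAME for the loop regularity `ε = 16(d+1)(d+4)L²α₀`). [cite: Balaban1985Averaging, (139)–(140) p.39, (109) p.34] -/
theorem ineq139_general_of_plaquettes {α₀ : ℝ} (hα₀ : 0 ≤ α₀)
    (hsmall : 512 * (d + 1) * (d + 4) * (L : ℝ) ^ 2 * α₀ ≤ 1)
    (hsmall' : 16 * (d + 1) * (d + 4) * (L : ℝ) ^ 2 * α₀ ≤ 1 / 8)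
    (h44 : ∀ (x : Site d) (κ κ' : Fin d), κ ≠ κ' → ‖((hol V₀ x (plaqWord κ κ') : 𝔸ˣ) : 𝔸) - 1‖ ≤ α₀) :
    ‖linQcov L V₀ A q κ‖ ≤
      avQ L (fun x μ => ‖A x μ‖) q κ
        + 1600 * (d + 1) * (d + 4) * (L : ℝ) ^ (d + 2) * α₀ * ddQ L (fun x μ => ‖A x μ‖) q κ := by
  have hWε : ∀ r : Fin d → Fin L,
      ‖((Wcx L V₀ q κ (boxVec L r) : 𝔸ˣ) : 𝔸) - 1‖ ≤ 16 * (d + 1) * (d + 4) * (L : ℝ) ^ 2 * α₀ :=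
    fun r => (B7Prop2Explicit.norm_Wcx_sub_one_le L hL V₀ hV₀ hα₀ hsmall h44 q κ r).trans (le_of_eq (by ring))
  have h := ineq139_general L hV₀ A hL q κ (by positivity) hsmall' hWε
  refine h.trans (le_of_eq ?_)
  ring

include hV₀ hL in
/-- **(139) FROM THE PLAQUETTE DEVIATION (52)** — the currency of the level backgrounds `Ū₀ʲ` (Prop. 2, p. 37 after (127)):
if `pdev V₀ < β ≤ 1/(1024(d+1)(d+4)L²)` then `‖L(Q(V₀)A)_c‖ ≤ avQ L |A| (c) + 1600(d+1)(d+4)L^{d+2}β·ddQ L |A| (c)` — the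
binder `h139` of `B7Prop5GeneralLinear`/`B7Prop5GeneralInduction` at one background (block loops `≤ 16(d+1)(d+4)L²β ≤ 1/64`
by `B7Eq123General.blockLoops_of_pdev`). [cite: Balaban1985Averaging, (139)–(140) p.39, (52) p.26, p.37 (after (127))] -/
theorem ineq139_general_of_pdev {β : ℝ} (hβ0 : 0 ≤ β) (hβ : pdev V₀ < β)
    (hβmax : β ≤ 1 / (1024 * ((d : ℝ) + 1) * ((d : ℝ) + 4) * (L : ℝ) ^ 2)) :
    ‖linQcov L V₀ A q κ‖ ≤
      avQ L (fun x μ => ‖A x μ‖) q κ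
        + 1600 * ((d : ℝ) + 1) * ((d : ℝ) + 4) * (L : ℝ) ^ (d + 2) * β * ddQ L (fun x μ => ‖A x μ‖) q κ := by
  obtain ⟨hloop, hsmall⟩ := blockLoops_of_pdev hL hV₀ hβ0 hβ hβmax q κ
  have h := ineq139_general L hV₀ A hL q κ (ε := 16 * ((d : ℝ) + 1) * ((d : ℝ) + 4) * (L : ℝ) ^ 2 * β)
    (by positivity) (hsmall.trans (by norm_num)) hloop
  refine h.trans (le_of_eq ?_)
  ring

end Majorant

end Literature.MathematicalPhysics.QuantumFieldTheory.Balaban1983to89.B7Ineq139General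

end
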